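import Summits.CriticalPhenomena.PercolationContinuityZ3.Theorems.PercNearOneGluingNoHeavyLowerTailSahiAllButTwo
import Summits.CriticalPhenomena.PercolationContinuityZ3.Theorems.PercNearOneGluingNoHeavyLowerTailSahiCTCN2Five

/-!
# `NoHeavyLowerTail` (crux stmt-CriticalPhenomena-4575), Sahi / Kahn positivity: **KAHN'S CONJECTURE 5 / SAHI'S `C₃` FOR THE MAJORITY-OF-FIVE
# FIRST SLOT** (the all-but-two event on a block of five coordinates), every interior product measure, all increasing `U, V`, every dimension

Support file (cell `prim-l12`, seat P3, gen 20; `--supports stmt-CriticalPhenomena-4575`; `--computational` through `…SahiCTCN2Five` and one small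
`native_decide` here).  Memo `run/shared/lean/prim/prim-l12/FROM-prim-l12-p3-g20-*.md`.

**THEOREM `sahiE_three_nonneg_of_allButTwo_five`.**  Let `e : Fin 5 ↪ ι` be a block of a finite product space with parameters in `(0,1)` on the
block, `H` an increasing event determined by the block whose pattern event is `allButTwo 5 = {at most two of the five closed} = {at least three of
the five open}` (MAJORITY OF FIVE).  Then `E₃(1_H, 1_U, 1_V) ≥ 0` for ALL increasing `U, V` (Kahn arXiv:2210.08653 Conj. 5 / Sahi 2008 `C₃` /
Gladkov–Zimin 2024b Conj. 2.6 for this first slot).  Majority of five is not a junta on `≤ 4` coordinates, not read-once, not a cascade, not a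
hitting/cylinder/all-but-one event: it is the first slot on FIVE coordinates beyond the tree's previous theorems.
PROOF = the c = 2 threshold certificate: `ρ₂ = μ(· | exactly two closed)` is a reduced transport certificate (`…SahiAllButTwo.rhoCert_allButTwo`)
because (a) `(Π+D)e₂ − ΘD ∈ ℕ[r]` on five variables (`coeff_aPoly_nonneg`, a 3125-entry table check) and (TC) `Ñ₂(K_𝒳,K_𝒵) ∈ ℕ[r]` for every pair of
complexes on five points (`…SahiCTCN2Five.coeff_N2gen_nonneg_fin5`, the kernel-checked finite enumeration).  Nothing is asserted about the crux.
-/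

noncomputable section

open scoped Classical

namespace Summit.CriticalPhenomena.PercolationContinuityZ3.Theorems

namespace SahiAllButTwo

open Finset MvPolynomial
open SahiHittingSlot SahiTransportCert SahiAllButOne SahiCTCForms SahiCTCGenFun SahiCTCForms.N2Five
open Literature.Combinatorics.Sahi2008
open Literature.Probability.Percolation (DeterminedBy)
open Literature.Probability.Percolation.DecisionTree (ind)

/-! ### Row (a) on five coordinates: `(Π + D)·e₂ − Θ·D ∈ ℕ[r]` -/

/-- The table of `(Π + D)·e₂ − Θ·D`. [this work] -/
def aTab : Array ℤ := subTab tabB (mulFam (mulFam oneTab ddC) thC)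

/-- The table check. [this work] -/
theorem aTab_nonneg : tabNonneg aTab = true := by native_decide

/-- `(Π + D)·e₂ − Θ·D` has degree `≤ 4` in each variable (indeed `≤ 2`). [this work] -/
theorem degreeOf_aPoly_le (i : Fin 5) : degreeOf i ((PiP + Dd) * ee 2 - Th * Dd : MvPolynomial (Fin 5) ℤ) ≤ 4 := by
  have hg : ∀ F : Finset (Finset (Fin 5)), degreeOf i (gf F) ≤ 1 := fun F => degreeOf_gf_le F i
  have hPi : degreeOf i (PiP : MvPolynomial (Fin 5) ℤ) ≤ 1 := hg _
  have hDd : degreeOf i (Dd : MvPolynomial (Fin 5) ℤ) ≤ 1 := hg _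
  have hTh : degreeOf i (Th : MvPolynomial (Fin 5) ℤ) ≤ 1 := hg _
  have he2 : degreeOf i (ee 2 : MvPolynomial (Fin 5) ℤ) ≤ 1 := hg _
  refine (degreeOf_sub_le i _ _).trans (max_le ?_ ?_)
  · refine (degreeOf_mul_le i _ _).trans ?_
    have := (degreeOf_add_le i (PiP : MvPolynomial (Fin 5) ℤ) Dd).trans (max_le hPi hDd)
    omega
  · refine (degreeOf_mul_le i _ _).trans ?_
    omega

/-- **Row (a) coefficientwise on five coordinates.** [this work] -/
theorem coeff_aPoly_nonneg (n : Fin 5 →₀ ℕ) : 0 ≤ ((PiP + Dd) * ee 2 - Th * Dd : MvPolynomial (Fin 5) ℤ).coeff n := by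
  have key : ∀ f : Fin 5 → Fin 5, aTab.getD (codeOf f) 0 = ((PiP * (ee 2 * 1) + Dd * (ee 2 * 1)) - Th * (Dd * 1) : MvPolynomial (Fin 5) ℤ).coeff (fsOf f) :=
    rep_sub (rep_add (rep_mulFam (rep_mulFam rep_one _) _) (rep_mulFam (rep_mulFam rep_one _) _)) (rep_mulFam (rep_mulFam rep_one _) _)
  by_cases hn : ∀ i, n i ≤ 4
  · obtain ⟨f, rfl⟩ := exists_fsOf_of_small hn
    have h := aTab_nonneg
    rw [tabNonneg, List.all_eq_true] at h
    have := of_decide_eq_true (h (codeOf f) (List.mem_range.2 (codeOf_lt f)))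
    rw [key f, show (PiP * (ee 2 * 1) + Dd * (ee 2 * 1) - Th * (Dd * 1) : MvPolynomial (Fin 5) ℤ) = (PiP + Dd) * ee 2 - Th * Dd by ring] at this
    exact this
  · have h0 : ((PiP + Dd) * ee 2 - Th * Dd : MvPolynomial (Fin 5) ℤ).coeff n = 0 := by
      by_contra h
      exact hn fun i => (degreeOf_le_iff.1 (degreeOf_aPoly_le i)) n (mem_support_iff.2 h)
    rw [h0]

/-- Row (a) at the odds vector of interior parameters on five coordinates. [this work] -/
theorem aRow_five {q : Fin 5 → unitInterval} (hq : ∀ i, 0 < (q i : ℝ) ∧ (q i : ℝ) < 1) :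
    ev q Th * ev q Dd ≤ (ev q PiP + ev q Dd) * ev q (ee 2 : MvPolynomial (Fin 5) ℤ) := by
  have h := eval_le_of_coeff_le (P := (0 : MvPolynomial (Fin 5) ℤ)) (Q := (PiP + Dd) * ee 2 - Th * Dd)
    (fun m => by rw [coeff_zero]; exact coeff_aPoly_nonneg m) (r q) (r_nonneg hq)
  rw [eval₂_zero, eval₂_sub, eval₂_mul, eval₂_mul, eval₂_add, sub_nonneg] at h
  exact h

/-- **KAHN'S CONJECTURE 5 / SAHI'S `C₃` FOR THE MAJORITY-OF-FIVE FIRST SLOT.**  For a block `e : Fin 5 ↪ ι` with interior parameters, an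
increasing event `H` determined by the block with pattern event `allButTwo 5` (at least three of the five coordinates open), and ALL increasing
`U, V ⊆ 2^ι`: `E₃(1_H, 1_U, 1_V) ≥ 0`. [this work] -/
theorem sahiE_three_nonneg_of_allButTwo_five {ι : Type} [Fintype ι] (p : ι → unitInterval) (e : Fin 5 ↪ ι)
    (hp : ∀ i, 0 < (p (e i) : ℝ) ∧ (p (e i) : ℝ) < 1) {H : Set (Set ι)} (hH : DeterminedBy H (Set.range e))
    (hpat : pat e H = allButTwo 5) {U V : Set (Set ι)} (hU : IsUpperSet U) (hV : IsUpperSet V) :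
    0 ≤ sahiE (bernoulliWeight p) 3 ![ind H, ind U, ind V] := by
  have hq : ∀ i, 0 < (pk e p i : ℝ) ∧ (pk e p i : ℝ) < 1 := hp
  refine sahiE_three_nonneg_of_allButTwo p e (by norm_num) hp (aRow_five hq) (fun 𝒳 𝒵 h𝒳 h𝒵 hX hZ => ?_) hH hpat hU hV
  exact eval_N2gen_nonneg_fin5 (isLowerSet_cx h𝒳) (isLowerSet_cx h𝒵) (empty_mem_cx h𝒳 hX) (empty_mem_cx h𝒵 hZ) _ (r_nonneg hq)

end SahiAllButTwo

end Summit.CriticalPhenomena.PercolationContinuityZ3.Theorems
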